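import Summits.CriticalPhenomena.PercolationContinuityZ3.Theorems.PercNearOneGluingNoHeavyLowerTailSahiGridPatternTopOnlyTop
import Summits.CriticalPhenomena.PercolationContinuityZ3.Theorems.PercNearOneGluingNoHeavyLowerTailSahiGridPatternFaces

/-!
# `NoHeavyLowerTail` (crux stmt-CriticalPhenomena-4575), Sahi programme: **THE PATTERN INEQUALITY WITH ONE ORTHANT SLOT,
# EVERY DIMENSION** — `sStarD (↑p) B C ≥ 0` for every principal filter `↑p ⊆ [3]^d` and arbitrary up-sets `B, C`

Support file (seat `prim-sahi-p1`, generation 9; `--supports stmt-CriticalPhenomena-4575`).  Pure proofs, no definitions, no `sorry`,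
standard axioms.  Vocabulary of `…SahiGridPattern{,Tensor,AllDim,SliceForm,Harris,Kleitman,TwoLayerTop,TopOnlyTop,Faces}`.

THE MATHEMATICS.  Slice an up-set of `[3]^{n+1}` along the last axis (`X_l = {q : snoc q l ∈ X}`, `X₀ ⊆ X₁ ⊆ X₂`).

* **Two-level lift** (`sum_sStarD_le_of_liftTwo`, every `n`): if `A ⊆ [3]^{n+1}` misses the bottom level and has equal middle and top
  slices (`A = D × {1,2}`), then for ARBITRARY up-sets `B, C ⊆ [3]^{n+1}`
  `Σ_{j,k ∈ {1,2}} sStarD D B_j C_k ≤ sStarD A B C`.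
  Proof: expand `sStarD A B C` into its eighteen level blocks (`block_eq`) and the four `sStarD D B_j C_k` by the counting form; the
  difference is `2·2^n·#{D ∩ (B₂∖B₁) ∩ (C₂∖C₁)} + [N(D;B₁,C₂)+N(D;B₂,C₁) − 2N(D;B₀,C₀)] + Σ_{i=1}^{4} (Kleitman slack_i)
  + L(D;B₂∖B₁,C₂∖C₁) ≥ 0`, the four Kleitman slacks being fibre Kleitman (`sum_ind_lat_le_td`) with the increments `B₁∖B₀`, `B₂∖B₀`,
  `C₁∖C₀`, `C₂∖C₀` as the free argument.  (For `A = D × {2}` the analogous lift `2·sStarD D B₂ C₂ ≤ sStarD A B C` is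
  `two_mul_sStarD_top_le_of_topOnly`; with a NONEMPTY bottom slice of `A` no such instance-blind lift exists.)
* **Orthant slot** (`sStarD_principal_nonneg`, every `d`): for every `p ∈ [3]^d` and all up-sets `B, C ⊆ [3]^d`,
  `0 ≤ sStarD {x : p ≤ x} B C`; likewise with the principal filter in the second or third slot.  Proof: induction on `d`; move a
  nonzero coordinate of `p` to the last axis (`tcD_perm`), then `↑p = ↑p' × {2}` (top-only lift) or `↑p' × {1,2}` (two-level lift);
  if `p = 0` the filter is the whole cube (`sStarD_nonneg_of_eq_univ₁`, coefficientwise Harris).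
  CONSEQUENCE (with `liebSahi_grid_of_patternPos`-type localisation, stated in the memo, not here): the homogeneous Sahi cubic
  `Z³E₃(1_A,1_B,1_C)` of a product weight on any finite grid `[K₁]×⋯×[K_d]` has nonnegative coefficients whenever `A` is an orthant
  `{x : x ≥ q}` and `B, C` are arbitrary up-sets — Sahi's `C₃` with one orthant slot, coefficientwise, in every dimension (the finite
  certificate version for `d ≤ 6` is prim-ineq-gen-4 gen 10's; this is the kernel proof for all `d`). [this work]
-/

namespace Summit.CriticalPhenomena.PercolationContinuityZ3.Theorems.SahiGridPattern

open Finset SahiGrid3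
open scoped BigOperators

variable {n : ℕ}

/-! ### Bookkeeping -/

/-- Values of the per-axis counts with first level in `{1,2}` (bookkeeping for the eighteen level blocks). [this work] -/
theorem c_vals_liftTwo :
    c1 (1:Fin 3) 0 0 = 0 ∧ c2 (1:Fin 3) 0 0 = 1 ∧ c2 (0:Fin 3) 1 0 = 0 ∧ c3 (1:Fin 3) 0 0 = 0 ∧ c1 (1:Fin 3) 0 1 = 0 ∧
    c2 (1:Fin 3) 0 1 = 0 ∧ c2 (0:Fin 3) 1 1 = 1 ∧ c2 (1:Fin 3) 1 0 = 0 ∧ c3 (1:Fin 3) 0 1 = 0 ∧ c1 (1:Fin 3) 0 2 = 0 ∧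
    c2 (1:Fin 3) 0 2 = 0 ∧ c2 (0:Fin 3) 1 2 = 0 ∧ c2 (2:Fin 3) 1 0 = 0 ∧ c3 (1:Fin 3) 0 2 = 1 ∧ c1 (1:Fin 3) 1 0 = 0 ∧
    c3 (1:Fin 3) 1 0 = 0 ∧ c1 (1:Fin 3) 1 1 = 2 ∧ c2 (1:Fin 3) 1 1 = 0 ∧ c3 (1:Fin 3) 1 1 = 0 ∧ c1 (1:Fin 3) 1 2 = 0 ∧
    c2 (1:Fin 3) 1 2 = 0 ∧ c2 (2:Fin 3) 1 1 = 1 ∧ c3 (1:Fin 3) 1 2 = 0 ∧ c1 (1:Fin 3) 2 0 = 0 ∧ c2 (1:Fin 3) 2 0 = 0 ∧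
    c3 (1:Fin 3) 2 0 = 1 ∧ c1 (1:Fin 3) 2 1 = 0 ∧ c2 (1:Fin 3) 2 1 = 0 ∧ c3 (1:Fin 3) 2 1 = 0 ∧ c1 (1:Fin 3) 2 2 = 0 ∧
    c2 (1:Fin 3) 2 2 = 1 ∧ c2 (2:Fin 3) 1 2 = 0 ∧ c3 (1:Fin 3) 2 2 = 0 ∧ c1 (2:Fin 3) 0 0 = 0 ∧ c2 (2:Fin 3) 0 0 = 1 ∧
    c2 (0:Fin 3) 2 0 = 0 ∧ c3 (2:Fin 3) 0 0 = 0 ∧ c1 (2:Fin 3) 0 1 = 0 ∧ c2 (2:Fin 3) 0 1 = 0 ∧ c2 (0:Fin 3) 2 1 = 0 ∧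
    c3 (2:Fin 3) 0 1 = 1 ∧ c1 (2:Fin 3) 0 2 = 0 ∧ c2 (2:Fin 3) 0 2 = 0 ∧ c2 (0:Fin 3) 2 2 = 1 ∧ c2 (2:Fin 3) 2 0 = 0 ∧
    c3 (2:Fin 3) 0 2 = 0 ∧ c1 (2:Fin 3) 1 0 = 0 ∧ c3 (2:Fin 3) 1 0 = 1 ∧ c1 (2:Fin 3) 1 1 = 0 ∧ c3 (2:Fin 3) 1 1 = 0 ∧
    c1 (2:Fin 3) 1 2 = 0 ∧ c2 (2:Fin 3) 2 1 = 0 ∧ c3 (2:Fin 3) 1 2 = 0 ∧ c1 (2:Fin 3) 2 0 = 0 ∧ c3 (2:Fin 3) 2 0 = 0 ∧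
    c1 (2:Fin 3) 2 1 = 0 ∧ c3 (2:Fin 3) 2 1 = 0 ∧ c1 (2:Fin 3) 2 2 = 2 ∧ c2 (2:Fin 3) 2 2 = 0 ∧ c3 (2:Fin 3) 2 2 = 0 := by
  unfold c1 c2 c3; decide

/-- A difference of nested finsets inside a double indicator sum against fixed weights (bookkeeping). [this work] -/
theorem sum2_ind_sdiff_first {x X : Finset (Pd n)} (h : x ⊆ X) (G : Pd n → ℤ) (H I : Pd n → Pd n → ℤ) :
    (∑ p, ∑ q, ind (X \ x) p * G q * H p q * I p q) =
      (∑ p, ∑ q, ind X p * G q * H p q * I p q) - ∑ p, ∑ q, ind x p * G q * H p q * I p q := by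
  rw [← Finset.sum_sub_distrib]; refine Finset.sum_congr rfl fun p _ => ?_
  rw [← Finset.sum_sub_distrib]; refine Finset.sum_congr rfl fun q _ => ?_
  rw [ind_sdiff_of_subset h]; ring

/-- Subset from a pointwise indicator inequality (bookkeeping). [this work] -/
theorem subset_of_ind_le {x X : Finset (Pd n)} (h : ∀ p, ind x p ≤ ind X p) : x ⊆ X := fun q hq => by
  have h1 := h q; unfold ind at h1; rw [if_pos hq] at h1
  by_contra hh; rw [if_neg hh] at h1; exact absurd h1 (by norm_num)

/-! ### The two-level lift `A = D × {1,2}` -/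

/-- **TWO-LEVEL LIFT** (every `n`): if the up-set `A ⊆ [3]^{n+1}` misses the bottom level of the last axis and its middle and top
slices coincide (`A = D × {1,2}`), then for ARBITRARY up-sets `B, C ⊆ [3]^{n+1}`
`sStarD D B₁ C₁ + sStarD D B₁ C₂ + sStarD D B₂ C₁ + sStarD D B₂ C₂ ≤ sStarD A B C` (`X_l` the level-`l` slice along the last axis).
The difference is `2·2^n·#(D∩(B₂∖B₁)∩(C₂∖C₁)) + [N(D;B₁,C₂)+N(D;B₂,C₁)−2N(D;B₀,C₀)] + (four fibre-Kleitman slacks with the increments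
B₁∖B₀, B₂∖B₀, C₁∖C₀, C₂∖C₀ as free argument) + L(D;B₂∖B₁,C₂∖C₁)`, each part nonnegative. [this work] -/
theorem sum_sStarD_le_of_liftTwo (A B C : Finset (Pd (n + 1)))
    (hA : IsUpperSet (A : Set (Pd (n + 1)))) (hB : IsUpperSet (B : Set (Pd (n + 1)))) (hC : IsUpperSet (C : Set (Pd (n + 1))))
    (hA0 : ∀ q : Pd n, (Fin.snoc q 0 : Pd (n + 1)) ∉ A)
    (hA12 : ∀ q : Pd n, (Fin.snoc q 1 : Pd (n + 1)) ∈ A ↔ (Fin.snoc q 2 : Pd (n + 1)) ∈ A) :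
    sStarD (univ.filter fun q : Pd n => (Fin.snoc q 2 : Pd (n + 1)) ∈ A) (univ.filter fun q : Pd n => (Fin.snoc q 1 : Pd (n + 1)) ∈ B)
        (univ.filter fun q : Pd n => (Fin.snoc q 1 : Pd (n + 1)) ∈ C)
    + sStarD (univ.filter fun q : Pd n => (Fin.snoc q 2 : Pd (n + 1)) ∈ A) (univ.filter fun q : Pd n => (Fin.snoc q 1 : Pd (n + 1)) ∈ B)
        (univ.filter fun q : Pd n => (Fin.snoc q 2 : Pd (n + 1)) ∈ C)
    + sStarD (univ.filter fun q : Pd n => (Fin.snoc q 2 : Pd (n + 1)) ∈ A) (univ.filter fun q : Pd n => (Fin.snoc q 2 : Pd (n + 1)) ∈ B)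
        (univ.filter fun q : Pd n => (Fin.snoc q 1 : Pd (n + 1)) ∈ C)
    + sStarD (univ.filter fun q : Pd n => (Fin.snoc q 2 : Pd (n + 1)) ∈ A) (univ.filter fun q : Pd n => (Fin.snoc q 2 : Pd (n + 1)) ∈ B)
        (univ.filter fun q : Pd n => (Fin.snoc q 2 : Pd (n + 1)) ∈ C)
      ≤ sStarD A B C := by
  -- the slices
  set D : Finset (Pd n) := univ.filter fun q : Pd n => (Fin.snoc q 2 : Pd (n + 1)) ∈ A with hDdef
  set P0 : Finset (Pd n) := univ.filter fun q : Pd n => (Fin.snoc q 0 : Pd (n + 1)) ∈ B with hP0def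
  set P1 : Finset (Pd n) := univ.filter fun q : Pd n => (Fin.snoc q 1 : Pd (n + 1)) ∈ B with hP1def
  set P2 : Finset (Pd n) := univ.filter fun q : Pd n => (Fin.snoc q 2 : Pd (n + 1)) ∈ B with hP2def
  set Q0 : Finset (Pd n) := univ.filter fun q : Pd n => (Fin.snoc q 0 : Pd (n + 1)) ∈ C with hQ0def
  set Q1 : Finset (Pd n) := univ.filter fun q : Pd n => (Fin.snoc q 1 : Pd (n + 1)) ∈ C with hQ1def
  set Q2 : Finset (Pd n) := univ.filter fun q : Pd n => (Fin.snoc q 2 : Pd (n + 1)) ∈ C with hQ2def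
  have iD2 : ∀ p, ind A (Fin.snoc p 2) = ind D p := fun p => by rw [hDdef, ind_filter_snoc]
  have iD1 : ∀ p, ind A (Fin.snoc p 1) = ind D p := fun p => by
    rw [← iD2 p]; unfold ind
    by_cases h : (Fin.snoc p 1 : Pd (n + 1)) ∈ A
    · rw [if_pos h, if_pos ((hA12 p).1 h)]
    · rw [if_neg h, if_neg (fun h2 => h ((hA12 p).2 h2))]
  have iA0 : ∀ p, ind A (Fin.snoc p 0) = 0 := fun p => by unfold ind; rw [if_neg (hA0 p)]
  have iP0 : ∀ p, ind B (Fin.snoc p 0) = ind P0 p := fun p => by rw [hP0def, ind_filter_snoc]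
  have iP1 : ∀ p, ind B (Fin.snoc p 1) = ind P1 p := fun p => by rw [hP1def, ind_filter_snoc]
  have iP2 : ∀ p, ind B (Fin.snoc p 2) = ind P2 p := fun p => by rw [hP2def, ind_filter_snoc]
  have iQ0 : ∀ p, ind C (Fin.snoc p 0) = ind Q0 p := fun p => by rw [hQ0def, ind_filter_snoc]
  have iQ1 : ∀ p, ind C (Fin.snoc p 1) = ind Q1 p := fun p => by rw [hQ1def, ind_filter_snoc]
  have iQ2 : ∀ p, ind C (Fin.snoc p 2) = ind Q2 p := fun p => by rw [hQ2def, ind_filter_snoc]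
  -- up-set and nesting facts
  have hDup : IsUpperSet (D : Set (Pd n)) := by rw [hDdef]; exact isUpperSet_filter_snoc hA 2
  have hP1up : IsUpperSet (P1 : Set (Pd n)) := by rw [hP1def]; exact isUpperSet_filter_snoc hB 1
  have hP2up : IsUpperSet (P2 : Set (Pd n)) := by rw [hP2def]; exact isUpperSet_filter_snoc hB 2
  have hQ1up : IsUpperSet (Q1 : Set (Pd n)) := by rw [hQ1def]; exact isUpperSet_filter_snoc hC 1
  have hQ2up : IsUpperSet (Q2 : Set (Pd n)) := by rw [hQ2def]; exact isUpperSet_filter_snoc hC 2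
  have nP01 : ∀ p, ind P0 p ≤ ind P1 p := fun p => by rw [← iP0, ← iP1]; exact ind_snoc_mono hB p (by decide)
  have nP02 : ∀ p, ind P0 p ≤ ind P2 p := fun p => by rw [← iP0, ← iP2]; exact ind_snoc_mono hB p (by decide)
  have nP12 : ∀ p, ind P1 p ≤ ind P2 p := fun p => by rw [← iP1, ← iP2]; exact ind_snoc_mono hB p (by decide)
  have nQ01 : ∀ p, ind Q0 p ≤ ind Q1 p := fun p => by rw [← iQ0, ← iQ1]; exact ind_snoc_mono hC p (by decide)
  have nQ02 : ∀ p, ind Q0 p ≤ ind Q2 p := fun p => by rw [← iQ0, ← iQ2]; exact ind_snoc_mono hC p (by decide)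
  have nQ12 : ∀ p, ind Q1 p ≤ ind Q2 p := fun p => by rw [← iQ1, ← iQ2]; exact ind_snoc_mono hC p (by decide)
  have sP01 : P0 ⊆ P1 := subset_of_ind_le nP01
  have sP02 : P0 ⊆ P2 := subset_of_ind_le nP02
  have sQ01 : Q0 ⊆ Q1 := subset_of_ind_le nQ01
  have sQ02 : Q0 ⊆ Q2 := subset_of_ind_le nQ02
  -- the value of sStarD A B C: eighteen level blocks
  have eA : sStarD A B C =
        4 * 2 ^ n * (∑ p, ind D p * ind P1 p * ind Q1 p) + 4 * 2 ^ n * (∑ p, ind D p * ind P2 p * ind Q2 p)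
      - 2 * (∑ p, ∑ q, ind D p * ind P0 q * ind Q0 q * (if TotDist p q = true then (1:ℤ) else 0))
      - (∑ p, ∑ q, ind D p * ind P1 q * ind Q1 q * (if TotDist p q = true then (1:ℤ) else 0))
      - (∑ p, ∑ q, ind D p * ind P2 q * ind Q2 q * (if TotDist p q = true then (1:ℤ) else 0))
      - (∑ p, ∑ q, ind P0 p * ind D q * ind Q1 q * (if TotDist p q = true then (1:ℤ) else 0))
      - (∑ p, ∑ q, ind P2 p * ind D q * ind Q1 q * (if TotDist p q = true then (1:ℤ) else 0))
      - (∑ p, ∑ q, ind P0 p * ind D q * ind Q2 q * (if TotDist p q = true then (1:ℤ) else 0))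
      - (∑ p, ∑ q, ind P1 p * ind D q * ind Q2 q * (if TotDist p q = true then (1:ℤ) else 0))
      - (∑ p, ∑ q, ind Q0 p * ind D q * ind P1 q * (if TotDist p q = true then (1:ℤ) else 0))
      - (∑ p, ∑ q, ind Q2 p * ind D q * ind P1 q * (if TotDist p q = true then (1:ℤ) else 0))
      - (∑ p, ∑ q, ind Q0 p * ind D q * ind P2 q * (if TotDist p q = true then (1:ℤ) else 0))
      - (∑ p, ∑ q, ind Q1 p * ind D q * ind P2 q * (if TotDist p q = true then (1:ℤ) else 0))
      + (∑ q, ∑ r, ind P0 q * ind Q2 r * ind D (thirdPt q r) * (if TotDist q r = true then (1:ℤ) else 0))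
      + (∑ q, ∑ r, ind P2 q * ind Q0 r * ind D (thirdPt q r) * (if TotDist q r = true then (1:ℤ) else 0))
      + (∑ q, ∑ r, ind P0 q * ind Q1 r * ind D (thirdPt q r) * (if TotDist q r = true then (1:ℤ) else 0))
      + (∑ q, ∑ r, ind P1 q * ind Q0 r * ind D (thirdPt q r) * (if TotDist q r = true then (1:ℤ) else 0)) := by
    rw [sStarD_eq_sum_ind]
    simp only [sum_snoc, Fin.sum_univ_three, iA0, iD1, iD2, iP0, iP1, iP2, iQ0, iQ1, iQ2, zero_mul,
      Finset.sum_const_zero, zero_add, Finset.sum_add_distrib]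
    rw [block_eq, block_eq, block_eq, block_eq, block_eq, block_eq, block_eq, block_eq, block_eq,
      block_eq, block_eq, block_eq, block_eq, block_eq, block_eq, block_eq, block_eq, block_eq]
    obtain ⟨h0, h1, h2, h3, h4, h5, h6, h7, h8, h9, h10, h11, h12, h13, h14, h15, h16, h17, h18, h19, h20, h21, h22, h23, h24,
      h25, h26, h27, h28, h29, h30, h31, h32, h33, h34, h35, h36, h37, h38, h39, h40, h41, h42, h43, h44, h45, h46, h47, h48,
      h49, h50, h51, h52, h53, h54, h55, h56, h57, h58, h59⟩ := c_vals_liftTwo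
    simp only [h0, h1, h2, h3, h4, h5, h6, h7, h8, h9, h10, h11, h12, h13, h14, h15, h16, h17, h18, h19, h20, h21, h22, h23, h24,
      h25, h26, h27, h28, h29, h30, h31, h32, h33, h34, h35, h36, h37, h38, h39, h40, h41, h42, h43, h44, h45, h46, h47, h48,
      h49, h50, h51, h52, h53, h54, h55, h56, h57, h58, h59]
    ring
  -- the four inner functionals in counting form
  have eT11 := sStarD_counting D P1 Q1
  have eT12 := sStarD_counting D P1 Q2
  have eT21 := sStarD_counting D P2 Q1
  have eT22 := sStarD_counting D P2 Q2
  -- fibre Kleitman with the increments as free argument (B-increments: first slot free)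
  have K1 := sum_ind_lat_le_td (P1 \ P0) hQ1up hDup
  rw [sum2_ind_sdiff_first sP01, sum2_ind_sdiff_first sP01] at K1
  have K3 := sum_ind_lat_le_td (P2 \ P0) hQ2up hDup
  rw [sum2_ind_sdiff_first sP02, sum2_ind_sdiff_first sP02] at K3
  -- (C-increments: swap the two summation variables to bring the increment to the first slot)
  have swapL : ∀ X Y : Finset (Pd n),
      (∑ p, ∑ q, ind Y p * ind X q * ind D (thirdPt p q) * (if TotDist p q = true then (1:ℤ) else 0)) =
      ∑ q, ∑ r, ind X q * ind Y r * ind D (thirdPt q r) * (if TotDist q r = true then (1:ℤ) else 0) := by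
    intro X Y
    rw [Finset.sum_comm]
    refine Finset.sum_congr rfl fun q _ => Finset.sum_congr rfl fun r _ => ?_
    rw [thirdPt_comm r q, totDist_symm r q]; ring
  have K2 := sum_ind_lat_le_td (Q1 \ Q0) hP1up hDup
  rw [sum2_ind_sdiff_first sQ01, sum2_ind_sdiff_first sQ01] at K2
  have K4 := sum_ind_lat_le_td (Q2 \ Q0) hP2up hDup
  rw [sum2_ind_sdiff_first sQ02, sum2_ind_sdiff_first sQ02] at K4
  have sw11 := swapL P1 Q1
  have sw10 := swapL P1 Q0
  have sw22 := swapL P2 Q2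
  have sw20 := swapL P2 Q0
  -- reorder the factors of the Kleitman right-hand sides into the block order
  have reord : ∀ X Y : Finset (Pd n),
      (∑ p, ∑ q, ind X p * ind Y q * ind D q * (if TotDist p q = true then (1:ℤ) else 0)) =
      ∑ p, ∑ q, ind X p * ind D q * ind Y q * (if TotDist p q = true then (1:ℤ) else 0) :=
    fun X Y => Finset.sum_congr rfl fun p _ => Finset.sum_congr rfl fun q _ => by ring
  have r11 := reord P1 Q1
  have r01 := reord P0 Q1
  have r22 := reord P2 Q2
  have r02 := reord P0 Q2
  have t11 := reord Q1 P1
  have t01 := reord Q0 P1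
  have t22 := reord Q2 P2
  have t02 := reord Q0 P2
  -- the increment × increment diagonal is nonnegative
  have F1 : 0 ≤ 2 ^ n * ((∑ p, ind D p * ind P1 p * ind Q1 p) + (∑ p, ind D p * ind P2 p * ind Q2 p)
      - (∑ p, ind D p * ind P1 p * ind Q2 p) - (∑ p, ind D p * ind P2 p * ind Q1 p)) := by
    refine mul_nonneg (pow_nonneg (by norm_num) n) ?_
    have e : ((∑ p, ind D p * ind P1 p * ind Q1 p) + (∑ p, ind D p * ind P2 p * ind Q2 p)
        - (∑ p, ind D p * ind P1 p * ind Q2 p) - (∑ p, ind D p * ind P2 p * ind Q1 p)) =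
        ∑ p, ind D p * ((ind P2 p - ind P1 p) * (ind Q2 p - ind Q1 p)) := by
      simp only [← Finset.sum_add_distrib, ← Finset.sum_sub_distrib]
      exact Finset.sum_congr rfl fun p _ => by ring
    rw [e]
    exact Finset.sum_nonneg fun p _ => mul_nonneg (ind_nonneg' D p) (mul_nonneg (by linarith [nP12 p]) (by linarith [nQ12 p]))
  -- the bottom pair term is dominated (twice)
  have F2a : (∑ p, ∑ q, ind D p * ind P0 q * ind Q0 q * (if TotDist p q = true then (1:ℤ) else 0)) ≤
      ∑ p, ∑ q, ind D p * ind P1 q * ind Q2 q * (if TotDist p q = true then (1:ℤ) else 0) := by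
    refine Finset.sum_le_sum fun p _ => Finset.sum_le_sum fun q _ => ?_
    have hm := mul_le_mul (nP01 q) (nQ02 q) (ind_nonneg' Q0 q) (ind_nonneg' P1 q)
    have h0 : 0 ≤ ind D p * (if TotDist p q = true then (1:ℤ) else 0) := mul_nonneg (ind_nonneg' D p) (by split_ifs <;> norm_num)
    calc ind D p * ind P0 q * ind Q0 q * (if TotDist p q = true then (1:ℤ) else 0)
        = (ind P0 q * ind Q0 q) * (ind D p * (if TotDist p q = true then (1:ℤ) else 0)) := by ring
      _ ≤ (ind P1 q * ind Q2 q) * (ind D p * (if TotDist p q = true then (1:ℤ) else 0)) := mul_le_mul_of_nonneg_right hm h0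
      _ = ind D p * ind P1 q * ind Q2 q * (if TotDist p q = true then (1:ℤ) else 0) := by ring
  have F2b : (∑ p, ∑ q, ind D p * ind P0 q * ind Q0 q * (if TotDist p q = true then (1:ℤ) else 0)) ≤
      ∑ p, ∑ q, ind D p * ind P2 q * ind Q1 q * (if TotDist p q = true then (1:ℤ) else 0) := by
    refine Finset.sum_le_sum fun p _ => Finset.sum_le_sum fun q _ => ?_
    have hm := mul_le_mul (nP02 q) (nQ01 q) (ind_nonneg' Q0 q) (ind_nonneg' P2 q)
    have h0 : 0 ≤ ind D p * (if TotDist p q = true then (1:ℤ) else 0) := mul_nonneg (ind_nonneg' D p) (by split_ifs <;> norm_num)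
    calc ind D p * ind P0 q * ind Q0 q * (if TotDist p q = true then (1:ℤ) else 0)
        = (ind P0 q * ind Q0 q) * (ind D p * (if TotDist p q = true then (1:ℤ) else 0)) := by ring
      _ ≤ (ind P2 q * ind Q1 q) * (ind D p * (if TotDist p q = true then (1:ℤ) else 0)) := mul_le_mul_of_nonneg_right hm h0
      _ = ind D p * ind P2 q * ind Q1 q * (if TotDist p q = true then (1:ℤ) else 0) := by ring
  -- the increment × increment Latin term is nonnegative
  have F3 : 0 ≤ (∑ q, ∑ r, ind P1 q * ind Q1 r * ind D (thirdPt q r) * (if TotDist q r = true then (1:ℤ) else 0))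
      + (∑ q, ∑ r, ind P2 q * ind Q2 r * ind D (thirdPt q r) * (if TotDist q r = true then (1:ℤ) else 0))
      - (∑ q, ∑ r, ind P1 q * ind Q2 r * ind D (thirdPt q r) * (if TotDist q r = true then (1:ℤ) else 0))
      - (∑ q, ∑ r, ind P2 q * ind Q1 r * ind D (thirdPt q r) * (if TotDist q r = true then (1:ℤ) else 0)) := by
    have e : (∑ q, ∑ r, ind P1 q * ind Q1 r * ind D (thirdPt q r) * (if TotDist q r = true then (1:ℤ) else 0))
        + (∑ q, ∑ r, ind P2 q * ind Q2 r * ind D (thirdPt q r) * (if TotDist q r = true then (1:ℤ) else 0))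
        - (∑ q, ∑ r, ind P1 q * ind Q2 r * ind D (thirdPt q r) * (if TotDist q r = true then (1:ℤ) else 0))
        - (∑ q, ∑ r, ind P2 q * ind Q1 r * ind D (thirdPt q r) * (if TotDist q r = true then (1:ℤ) else 0)) =
        ∑ q, ∑ r, (ind P2 q - ind P1 q) * (ind Q2 r - ind Q1 r) * (ind D (thirdPt q r) * (if TotDist q r = true then (1:ℤ) else 0)) := by
      simp only [← Finset.sum_add_distrib, ← Finset.sum_sub_distrib]
      exact Finset.sum_congr rfl fun q _ => Finset.sum_congr rfl fun r _ => by ring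
    rw [e]
    refine Finset.sum_nonneg fun q _ => Finset.sum_nonneg fun r _ => ?_
    exact mul_nonneg (mul_nonneg (by linarith [nP12 q]) (by linarith [nQ12 r]))
      (mul_nonneg (ind_nonneg' D _) (by split_ifs <;> norm_num))
  rw [eT11, eT12, eT21, eT22, eA]
  linarith [K1, K2, K3, K4, sw11, sw10, sw22, sw20, r11, r01, r22, r02, t11, t01, t22, t02, F1, F2a, F2b, F3]

/-! ### The orthant slot -/

/-- A principal filter `{x : p ≤ x}` of `[3]^d` is an up-set. [this work] -/
theorem isUpperSet_filter_le {d : ℕ} (p : Pd d) : IsUpperSet ((univ.filter fun x : Pd d => ∀ a, p a ≤ x a : Finset (Pd d)) : Set (Pd d)) := by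
  intro x y hxy hx
  rw [Finset.mem_coe, Finset.mem_filter] at hx ⊢
  exact ⟨Finset.mem_univ _, fun a => le_trans (hx.2 a) (hxy a)⟩

/-- Slices of a principal filter along the last axis: `snoc x l ≥ q` iff `x ≥ init q` and `l ≥ q last`. [this work] -/
theorem le_snoc_iff (q : Pd (n + 1)) (x : Pd n) (l : Fin 3) :
    (∀ a, q a ≤ (Fin.snoc x l : Pd (n + 1)) a) ↔ ((∀ b : Fin n, q (Fin.castSucc b) ≤ x b) ∧ q (Fin.last n) ≤ l) := by
  constructor
  · intro h
    refine ⟨fun b => ?_, ?_⟩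
    · have := h (Fin.castSucc b); simpa [Fin.snoc_castSucc] using this
    · have := h (Fin.last n); simpa [Fin.snoc_last] using this
  · rintro ⟨h1, h2⟩ a
    refine Fin.lastCases ?_ (fun b => ?_) a
    · simpa [Fin.snoc_last] using h2
    · simpa [Fin.snoc_castSucc] using h1 b

/-- The inductive step: a principal filter whose LAST threshold is nonzero, given the orthant theorem one dimension down. [this work] -/
theorem sStarD_filter_le_nonneg_step
    (ih : ∀ (p' : Pd n) (B C : Finset (Pd n)), IsUpperSet (B : Set (Pd n)) → IsUpperSet (C : Set (Pd n)) →
      0 ≤ sStarD (univ.filter fun x : Pd n => ∀ b, p' b ≤ x b) B C)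
    (q : Pd (n + 1)) (hq : q (Fin.last n) ≠ 0) (B C : Finset (Pd (n + 1)))
    (hB : IsUpperSet (B : Set (Pd (n + 1)))) (hC : IsUpperSet (C : Set (Pd (n + 1)))) :
    0 ≤ sStarD (univ.filter fun x : Pd (n + 1) => ∀ a, q a ≤ x a) B C := by
  set A : Finset (Pd (n + 1)) := univ.filter fun x : Pd (n + 1) => ∀ a, q a ≤ x a with hAdef
  have hA : IsUpperSet (A : Set (Pd (n + 1))) := by rw [hAdef]; exact isUpperSet_filter_le q
  set p' : Pd n := fun b => q (Fin.castSucc b) with hp'def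
  have memA : ∀ (x : Pd n) (l : Fin 3), (Fin.snoc x l : Pd (n + 1)) ∈ A ↔ ((∀ b, p' b ≤ x b) ∧ q (Fin.last n) ≤ l) := by
    intro x l; rw [hAdef, Finset.mem_filter, le_snoc_iff]; simp [hp'def]
  have hA0 : ∀ x : Pd n, (Fin.snoc x 0 : Pd (n + 1)) ∉ A := by
    intro x h; rw [memA] at h
    exact hq (le_antisymm h.2 (Fin.zero_le _))
  have topA : (univ.filter fun x : Pd n => (Fin.snoc x 2 : Pd (n + 1)) ∈ A) = univ.filter fun x : Pd n => ∀ b, p' b ≤ x b := by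
    ext x; simp only [Finset.mem_filter, Finset.mem_univ, true_and, memA]
    have l2 : ∀ i : Fin 3, i ≤ 2 := by decide
    constructor
    · exact fun h => h.1
    · intro h; exact ⟨h, l2 _⟩
  have hcases : q (Fin.last n) = 1 ∨ q (Fin.last n) = 2 := by
    have key : ∀ i : Fin 3, i ≠ 0 → i = 1 ∨ i = 2 := by decide
    exact key _ hq
  have hB1 := isUpperSet_filter_snoc hB 1
  have hB2 := isUpperSet_filter_snoc hB 2
  have hC1 := isUpperSet_filter_snoc hC 1
  have hC2 := isUpperSet_filter_snoc hC 2
  rcases hcases with h1 | h2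
  · -- two-level lift
    have hA12 : ∀ x : Pd n, (Fin.snoc x 1 : Pd (n + 1)) ∈ A ↔ (Fin.snoc x 2 : Pd (n + 1)) ∈ A := by
      intro x; rw [memA, memA, h1]; simp
    have L := sum_sStarD_le_of_liftTwo A B C hA hB hC hA0 hA12
    rw [topA] at L
    have i11 := ih p' _ _ hB1 hC1
    have i12 := ih p' _ _ hB1 hC2
    have i21 := ih p' _ _ hB2 hC1
    have i22 := ih p' _ _ hB2 hC2
    linarith
  · -- top-only lift
    have hA1 : ∀ x : Pd n, (Fin.snoc x 1 : Pd (n + 1)) ∉ A := by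
      intro x h; rw [memA, h2] at h
      exact absurd h.2 (by decide : ¬ ((2:Fin 3) ≤ 1))
    have L := two_mul_sStarD_top_le_of_topOnly A B C hA hB hC hA0 hA1
    rw [topA] at L
    have i22 := ih p' _ _ hB2 hC2
    linarith

/-- **THE PATTERN INEQUALITY WITH ONE ORTHANT SLOT, EVERY DIMENSION**: for every `d`, every `p ∈ [3]^d` and all up-sets
`B, C ⊆ [3]^d`, `0 ≤ sStarD {x : p ≤ x} B C`.  (Equivalently: the homogeneous Sahi cubic of a product weight on a `d`-dimensional grid
has nonnegative coefficients when one of the three up-sets is an orthant; `PatternPos d` restricted to one principal-filter slot.)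
Proof: induction on `d`, moving a nonzero threshold of `p` to the last axis by an axis symmetry (`slicePos_perm`), then the top-only
lift (`two_mul_sStarD_top_le_of_topOnly`) or the two-level lift (`sum_sStarD_le_of_liftTwo`); `p = 0` is the whole-cube face. [this work] -/
theorem sStarD_principal_nonneg : ∀ (d : ℕ) (p : Pd d) (B C : Finset (Pd d)),
    IsUpperSet (B : Set (Pd d)) → IsUpperSet (C : Set (Pd d)) → 0 ≤ sStarD (univ.filter fun x : Pd d => ∀ a, p a ≤ x a) B C := by
  intro d
  induction d with
  | zero =>
    intro p B C hB hC
    have e : (univ.filter fun x : Pd 0 => ∀ a, p a ≤ x a) = univ := by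
      ext x; simp only [Finset.mem_filter, Finset.mem_univ, true_and, iff_true]
      exact fun a => Fin.elim0 a
    rw [e]; exact sStarD_nonneg_of_eq_univ₁ hB hC
  | succ n ih =>
    intro p B C hB hC
    by_cases hz : ∃ a, p a ≠ 0
    · obtain ⟨a, ha⟩ := hz
      -- move axis `a` to the last position
      let τ : Equiv.Perm (Fin (n + 1)) := Equiv.swap a (Fin.last n)
      have hq : (p ∘ τ) (Fin.last n) ≠ 0 := by
        show p (τ (Fin.last n)) ≠ 0
        rw [Equiv.swap_apply_right]; exact ha
      have step : ∀ B' C' : Finset (Pd (n + 1)), IsUpperSet (B' : Set (Pd (n + 1))) → IsUpperSet (C' : Set (Pd (n + 1))) →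
          0 ≤ ∑ x ∈ (univ.filter fun x : Pd (n + 1) => ∀ a, (p ∘ τ) a ≤ x a), ∑ y ∈ B', ∑ z ∈ C', tcD x y z := by
        intro B' C' hB' hC'
        rw [← sStarD_eq_sum_tcD]
        exact sStarD_filter_le_nonneg_step ih (p ∘ τ) hq B' C' hB' hC'
      have hmem : ∀ x : Pd (n + 1), x ∈ (univ.filter fun x : Pd (n + 1) => ∀ a, p a ≤ x a) ↔
          x ∘ τ ∈ (univ.filter fun x : Pd (n + 1) => ∀ a, (p ∘ τ) a ≤ x a) := by
        intro x
        simp only [Finset.mem_filter, Finset.mem_univ, true_and, Function.comp_apply]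
        constructor
        · intro h b; exact h (τ b)
        · intro h b
          have := h (τ.symm b)
          simpa using this
      rw [sStarD_eq_sum_tcD]
      exact slicePos_perm τ step hmem B C hB hC
    · simp only [not_exists, not_not] at hz
      have e : (univ.filter fun x : Pd (n + 1) => ∀ a, p a ≤ x a) = univ := by
        ext x; simp only [Finset.mem_filter, Finset.mem_univ, true_and, iff_true]
        intro a; rw [hz a]; exact Fin.zero_le _
      rw [e]; exact sStarD_nonneg_of_eq_univ₁ hB hC

/-- Orthant in the second slot. [this work] -/
theorem sStarD_principal_nonneg₂ {d : ℕ} (p : Pd d) {A C : Finset (Pd d)}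
    (hA : IsUpperSet (A : Set (Pd d))) (hC : IsUpperSet (C : Set (Pd d))) :
    0 ≤ sStarD A (univ.filter fun x : Pd d => ∀ a, p a ≤ x a) C := by
  rw [sStarD_swap12]; exact sStarD_principal_nonneg d p A C hA hC

/-- Orthant in the third slot. [this work] -/
theorem sStarD_principal_nonneg₃ {d : ℕ} (p : Pd d) {A B : Finset (Pd d)}
    (hA : IsUpperSet (A : Set (Pd d))) (hB : IsUpperSet (B : Set (Pd d))) :
    0 ≤ sStarD A B (univ.filter fun x : Pd d => ∀ a, p a ≤ x a) := by
  rw [sStarD_swap23, sStarD_swap12]; exact sStarD_principal_nonneg d p A B hA hB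

end Summit.CriticalPhenomena.PercolationContinuityZ3.Theorems.SahiGridPattern
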